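/-
Copyright (c) 2026 the pub-hodgecm-mathlib formalisation cell (harness21).  Prover seat hodgecm-mathlib-LH4-p07 (g12): Track B «K2-LIT» valve hand,
hLiu418 = stmt-HodgeConjecture-24832; (σ-A) road desk K2Liu-p25 (g3) WORD #5 (2) ∕ #9 (1) ∕ #12 (1) «(an-1) the null-cone Radon measure»; LEAD F0P6-plan (g15)
RULING M-160f.  FILE B of (an-1): the measure.
-/
import Summits.HodgeConjecture.HodgeConjecture.Theorems.K2LiuNullConeFunctional          -- (an-1) FILE A (this seat): the null-cone functional on real Schwartz–Bruhat functions
import Literature.MeasureTheory.RieszRepresentation.PositiveFunctionalExtension        -- ★ the sandwich road: `sandwichMeasure`, `integral_sandwichMeasure_eq_of_mem`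
import HarnessLib

/-!
# Crux `HLiu418`, road `K2_Liu`, (σ-A) mini-road, brick (an-1) FILE B: THE NULL-CONE RADON MEASURE `σ` ON `K^ι` — `∫ Ψ dσ = ∫_β ∫_x Ψ·ψ(βQ)` for every
# Schwartz–Bruhat `Ψ`, `σ{Q ≠ 0} = 0`, the vertex mass law `σ((𝔭^{n+1})^ι) = q^{−card ι}·q²·σ((𝔭^n)^ι)`, and `σ{0} = 0`

Cell `hodgecm-mathlib`, crux item hLiu418 = `stmt-HodgeConjecture-24832`; squad K2 ∕ K2Liu (L1); prover LH4-p07 (g12).  THEOREMS ONLY (no `def`, no `instance`, no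
`notation`, no named-fact hypothesis, no `sorry`, default heartbeats); lane `--supports stmt-HodgeConjecture-24832 --as helper` (count-neutral helper; closes no socket).

THE ROAD (desk WORD #12 «=»).  `L :=` the REAL Schwartz–Bruhat functions on `K^ι` (`((SchwartzBruhat (ι → K)).restrictScalars ℝ).comap (ofReal ∘ ·)`, built inside the
proof), `S Φ := Re ∫_β ∫_x Φ(x)·ψ(β Q x) dμ^ι dμ` (FILE A: additive, homogeneous, POSITIVE as the limit of the non-negative ball averages, monotone); FILE A §5 gives the
Darboux sandwich of every `g ∈ C_c(K^ι, ℝ)` between `Φ ∓ δ·1_B`; ★ `RieszRepresentation.sandwichMeasure` then IS the measure, `integral_sandwichMeasure_eq_of_mem` identifies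
`∫ Φ dσ = S Φ` on `L` (every `Φ ∈ L` is its own compactly supported approximant).  Everything else is read off that identity ALONE (§1–§4 are stated for ANY measure
`σ` with `∀ Φ ∈ L, ∫ Φ dσ = S Φ`): the complex identity (§1), the support (§2: a box-coset inside `{Q ≠ 0}` is clopen, its indicator is in `L ∩ C_c`, its `S`-value
vanishes by FILE A §3; ★ Mathlib `measure_null_of_locally_null`), the vertex mass law (§3, FILE A §4) and the vertex (§4: `σ((𝔭^n)^ι) = c^n σ((𝔭^0)^ι) → 0`, `c = q^{2−card ι} < 1`).
* §5 **`exists_nullConeMeasure`** — `∃ σ : Measure (ι → K), σ.Regular ∧ IsFiniteMeasureOnCompacts σ ∧ (∀ Ψ ∈ 𝒮(K^ι), Integrable Ψ σ ∧ ∫ Ψ dσ = ∫_β ∫_x Ψ x * ψ(β * Q x) ∂μ^ι ∂μ)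
  ∧ σ {x | Q x ≠ 0} = 0 ∧ (∀ n, σ.real((𝔭^{n+1})^ι) = ((q⁻¹)^{card ι}·q²)·σ.real((𝔭^n)^ι)) ∧ σ {0} = 0` — the RHS of the first clause is LITERALLY ★ p864232 §1's double
  integral (so ★ p864307 §2–§3 rewrite stage A at `½` as `γ∕L_F(2)·∫ Ψ_g dσ` BY NAME), the two null-set letters are (an-3)'s `hZ` inputs on the `s`-slot, and the mass
  law is the local-finiteness input of (an-3)'s pair carrier at the vertex (`Σ_n q^{2n}σ((𝔭^n)^ι) < ∞ ⇔ card ι > 4`; `card ι = 6` in the application).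
NOT here: the `GL`-homogeneity of `σ` (not needed by ★ [A4-close], desk WORD #12 (c)); the ball-average limit for non-locally-constant `g ∈ C_c` (not needed; it follows
from the sandwich).  HONEST LABEL.  `HC_CM` is proved only modulo the 7 printed citations (2 remaining named inputs: hLiu418 = `stmt-HodgeConjecture-24832`,
h413 = `stmt-HodgeConjecture-24833`) until rung 0 closes; count-neutral helper, closes no socket; `hcone` and the carrier of `hZ` stay BY VALUE (R2) until (an-2)–(an-3) are ★.

## References
* [Weil1965] A. Weil, *Sur la formule de Siegel dans la théorie des groupes classiques*, Acta Math. 113 (1965), Chap. I n° 2 Lemme 3 (p. 7); Chap. III n° 36 Prop. 6 (p. 54).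
* [Rudin1987] W. Rudin, *Real and Complex Analysis* (1987), Thm. 2.14, Thm. 2.18.
* [KudlaRallis1994] S. Kudla, S. Rallis, Ann. of Math. 140 (1994), §5 (5.3)–(5.6).
-/

set_option autoImplicit false
set_option linter.dupNamespace false -- the mandated namespace repeats `HodgeConjecture.HodgeConjecture`

noncomputable section

namespace Summit.HodgeConjecture.HodgeConjecture.Cruxes.HLiu418.K2LiuNullConeRadonMeasure

open MeasureTheory Filter Topology Set Matrix CompactlySupported
open scoped NNReal Pointwise
open Literature.NumberTheory.GaloisRepresentations.IsNonarchimedeanLocalField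
open Literature.NumberTheory.Automorphic Literature.NumberTheory.Weil1964 Literature.NumberTheory.Weil1965
open Literature.MeasureTheory.RieszRepresentation
open Summit.HodgeConjecture.HodgeConjecture.Cruxes.HLiu418.K2LiuRankOneStageIntegralsAtHalf
open Summit.HodgeConjecture.HodgeConjecture.Cruxes.HLiu418.K2LiuNullConeFunctional

variable {K : Type*} [Field K] [ValuativeRel K] [TopologicalSpace K] [IsNonarchimedeanLocalField K]
variable {ι : Type*} [Fintype ι] [MeasurableSpace K] [BorelSpace K] (μ : Measure K) [μ.IsAddHaarMeasure] {ψ : AddChar K Circle}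

/-! ## §0 Casting real indicators and real parts into `𝒮(K^ι)` -/

omit [Fintype ι] [MeasurableSpace K] [BorelSpace K] in
/-- the complexification of the real indicator of a box coset is the complex indicator, a Schwartz–Bruhat function. [cite: Rudin1987, Ch. 2, Thm. 2.14] -/
theorem ofReal_indicator_vadd_piPrimePowBall_mem (N : ℤ) (a : ι → K) :
    (fun x => (((a +ᵥ piPrimePowBall K ι N).indicator (1 : (ι → K) → ℝ) x : ℝ) : ℂ)) = (a +ᵥ piPrimePowBall K ι N).indicator fun _ => (1 : ℂ) := by
  funext x
  by_cases hx : x ∈ a +ᵥ piPrimePowBall K ι N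
  · rw [Set.indicator_of_mem hx, Set.indicator_of_mem hx, Pi.one_apply, Complex.ofReal_one]
  · rw [Set.indicator_of_notMem hx, Set.indicator_of_notMem hx, Complex.ofReal_zero]

omit [Fintype ι] [MeasurableSpace K] [BorelSpace K] in
/-- the same for a box. [cite: Rudin1987, Ch. 2, Thm. 2.14] -/
theorem ofReal_indicator_piPrimePowBall_mem (N : ℤ) :
    (fun x => (((piPrimePowBall K ι N).indicator (1 : (ι → K) → ℝ) x : ℝ) : ℂ)) = (piPrimePowBall K ι N).indicator fun _ => (1 : ℂ) := by
  funext x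
  by_cases hx : x ∈ piPrimePowBall K ι N
  · rw [Set.indicator_of_mem hx, Set.indicator_of_mem hx, Pi.one_apply, Complex.ofReal_one]
  · rw [Set.indicator_of_notMem hx, Set.indicator_of_notMem hx, Complex.ofReal_zero]

omit [Field K] [ValuativeRel K] [IsNonarchimedeanLocalField K] [Fintype ι] [MeasurableSpace K] [BorelSpace K] in
/-- the real and imaginary parts of a Schwartz–Bruhat function complexify to Schwartz–Bruhat functions. [cite: Rudin1987, Ch. 2, Thm. 2.14] -/
theorem ofReal_re_mem_of_mem {Ψ : (ι → K) → ℂ} (hΨ : Ψ ∈ SchwartzBruhat (ι → K)) :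
    (fun x => (((Ψ x).re : ℝ) : ℂ)) ∈ SchwartzBruhat (ι → K) ∧ (fun x => (((Ψ x).im : ℝ) : ℂ)) ∈ SchwartzBruhat (ι → K) := by
  rw [mem_schwartzBruhat_iff] at hΨ ⊢
  refine ⟨⟨hΨ.1.comp fun z : ℂ => ((z.re : ℝ) : ℂ), ?_⟩, (mem_schwartzBruhat_iff).2 ⟨hΨ.1.comp fun z : ℂ => ((z.im : ℝ) : ℂ), ?_⟩⟩
  · exact hΨ.2.comp_left (g := fun z : ℂ => ((z.re : ℝ) : ℂ)) (by simp)
  · exact hΨ.2.comp_left (g := fun z : ℂ => ((z.im : ℝ) : ℂ)) (by simp)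

/-! ## §1 From the real identity on `L` to the complex identity on `𝒮(K^ι)` -/

/-- **ANY measure integrating every real Schwartz–Bruhat `Φ` to `Re ∫∫ Φ ψ(βQ)` integrates every COMPLEX Schwartz–Bruhat `Ψ` to `∫_β ∫_x Ψ(x)·ψ(β Q x) dμ^ι dμ`** (split into real
and imaginary parts; each real double integral is REAL by FILE A §1). [cite: Weil1965, Chap. I n° 2 Lemme 3, p. 7] -/
theorem integral_eq_nullConeIntegral_of_forall_real [Invertible (2 : K)] {d : ℤ} (hd : ψ.HasConductorExp d) {v₂ : ℤ}
    (h2 : normAbs K (2 : K) = (residueFieldCard K : ℝ≥0)⁻¹ ^ v₂) (Q : QuadraticForm K (ι → K))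
    (hQ : (QuadraticMap.associated (R := K) Q).SeparatingLeft) (hr : 3 ≤ Fintype.card ι)
    (σ : Measure (ι → K))
    (hP : ∀ Φ : (ι → K) → ℝ, (fun x => (Φ x : ℂ)) ∈ SchwartzBruhat (ι → K) →
      Integrable Φ σ ∧ ∫ x, Φ x ∂σ = (∫ β, ∫ x, (Φ x : ℂ) * ((ψ (β * Q x) : Circle) : ℂ) ∂(Measure.pi fun _ : ι => μ) ∂μ).re)
    {Ψ : (ι → K) → ℂ} (hΨ : Ψ ∈ SchwartzBruhat (ι → K)) :
    Integrable Ψ σ ∧ ∫ x, Ψ x ∂σ = ∫ β, ∫ x, Ψ x * ((ψ (β * Q x) : Circle) : ℂ) ∂(Measure.pi fun _ : ι => μ) ∂μ := by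
  obtain ⟨hre, him⟩ := ofReal_re_mem_of_mem hΨ
  obtain ⟨hrei, hreI⟩ := hP (fun x => (Ψ x).re) hre
  obtain ⟨himi, himI⟩ := hP (fun x => (Ψ x).im) him
  set A : ℂ := ∫ β, ∫ x, (((Ψ x).re : ℝ) : ℂ) * ((ψ (β * Q x) : Circle) : ℂ) ∂(Measure.pi fun _ : ι => μ) ∂μ with hA
  set B : ℂ := ∫ β, ∫ x, (((Ψ x).im : ℝ) : ℂ) * ((ψ (β * Q x) : Circle) : ℂ) ∂(Measure.pi fun _ : ι => μ) ∂μ with hB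
  have hAim : A.im = 0 := (tendsto_ballAverageReal_nullCone μ hd h2 Q hQ hr hre).2
  have hBim : B.im = 0 := (tendsto_ballAverageReal_nullCone μ hd h2 Q hQ hr him).2
  have hAre : ((A.re : ℝ) : ℂ) = A := Complex.ext (by simp) (by simp [hAim])
  have hBre : ((B.re : ℝ) : ℂ) = B := Complex.ext (by simp) (by simp [hBim])
  -- `Ψ = re Ψ + I · im Ψ`
  have hsplit : ∀ x, Ψ x = (((Ψ x).re : ℝ) : ℂ) + Complex.I * (((Ψ x).im : ℝ) : ℂ) := fun x => by
    rw [mul_comm]; exact (Complex.re_add_im (Ψ x)).symm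
  have h1 : Integrable (fun x => (((Ψ x).re : ℝ) : ℂ)) σ := hrei.ofReal
  have h2i : Integrable (fun x => Complex.I * (((Ψ x).im : ℝ) : ℂ)) σ := (himi.ofReal (𝕜 := ℂ)).const_mul Complex.I
  have hint : Integrable Ψ σ := (h1.add h2i).congr (Eventually.of_forall fun x => (hsplit x).symm)
  refine ⟨hint, ?_⟩
  -- left side
  have hL : ∫ x, Ψ x ∂σ = A + Complex.I * B := by
    rw [integral_congr_ae (Eventually.of_forall hsplit), integral_add h1 h2i, integral_const_mul, integral_complex_ofReal,
      integral_complex_ofReal, hreI, himI, hAre, hBre]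
  -- right side
  have him' : (fun x => Complex.I * (((Ψ x).im : ℝ) : ℂ)) ∈ SchwartzBruhat (ι → K) := by
    have h := Submodule.smul_mem (SchwartzBruhat (ι → K)) Complex.I him
    simpa only [Pi.smul_def, smul_eq_mul] using h
  have hR : ∫ β, ∫ x, Ψ x * ((ψ (β * Q x) : Circle) : ℂ) ∂(Measure.pi fun _ : ι => μ) ∂μ = A + Complex.I * B := by
    rw [hA, hB, ← nullConeIntegral_smul μ Q Complex.I, ← nullConeIntegral_add μ hd h2 Q hQ hr hre him']
    refine integral_congr_ae (Eventually.of_forall fun β => integral_congr_ae (Eventually.of_forall fun x => ?_))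
    exact congrArg (fun z : ℂ => z * ((ψ (β * Q x) : Circle) : ℂ)) (hsplit x)
  rw [hL, hR]

/-! ## §2 Support: such a measure is carried by the null cone `{Q = 0}` -/

/-- **SUPPORT IN THE NULL CONE**: a measure finite on compact sets that integrates every real Schwartz–Bruhat `Φ` to `Re ∫∫ Φ ψ(βQ)` gives measure `0` to `{Q ≠ 0}` — around
each point of the open set `{Q ≠ 0}` some box coset lies inside it; its indicator is a real Schwartz–Bruhat function whose null-cone value vanishes (FILE A §3); ★ Mathlib
`measure_null_of_locally_null`. [cite: Weil1965, Chap. I n° 2 Lemme 3, p. 7] -/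
theorem measure_setOf_ne_zero_eq_zero_of_forall_real [Invertible (2 : K)] {d : ℤ} (hd : ψ.HasConductorExp d) {v₂ : ℤ}
    (h2 : normAbs K (2 : K) = (residueFieldCard K : ℝ≥0)⁻¹ ^ v₂) (Q : QuadraticForm K (ι → K))
    (hQ : (QuadraticMap.associated (R := K) Q).SeparatingLeft) (hr : 3 ≤ Fintype.card ι)
    (σ : Measure (ι → K)) [IsFiniteMeasureOnCompacts σ]
    (hP : ∀ Φ : (ι → K) → ℝ, (fun x => (Φ x : ℂ)) ∈ SchwartzBruhat (ι → K) →
      Integrable Φ σ ∧ ∫ x, Φ x ∂σ = (∫ β, ∫ x, (Φ x : ℂ) * ((ψ (β * Q x) : Circle) : ℂ) ∂(Measure.pi fun _ : ι => μ) ∂μ).re) :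
    σ {x | Q x ≠ 0} = 0 := by
  haveI : SecondCountableTopology K := secondCountableTopology_localField K
  haveI : T2Space K := (Literature.NumberTheory.GaloisRepresentations.IsNonarchimedeanLocalField.isLocalField K).toT2Space
  have hQc : Continuous (Q : (ι → K) → K) := continuous_quadraticForm Q hQ
  have hU : IsOpen {x : ι → K | Q x ≠ 0} := isOpen_ne_fun hQc continuous_const
  refine measure_null_of_locally_null _ fun x₀ hx₀ => ?_
  -- a box coset around `x₀` inside `{Q ≠ 0}`
  have hW : (fun t => x₀ + t) ⁻¹' {x : ι → K | Q x ≠ 0} ∈ 𝓝 (0 : ι → K) :=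
    (continuous_const.add continuous_id).continuousAt.preimage_mem_nhds (by simpa using hU.mem_nhds hx₀)
  obtain ⟨m, hm⟩ := exists_piPrimePowBall_subset_of_mem_nhds_zero hW
  set u : Set (ι → K) := x₀ +ᵥ piPrimePowBall K ι (m : ℤ) with hu
  have huU : u ⊆ {x : ι → K | Q x ≠ 0} := by
    intro x hx
    obtain ⟨t, ht, rfl⟩ := Set.mem_vadd_set.1 hx
    exact hm ht
  have huo : IsOpen u := isOpen_vadd_piPrimePowBall (m : ℤ) x₀
  have huc : IsCompact u := isCompact_vadd_piPrimePowBall (m : ℤ) x₀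
  refine ⟨u, mem_nhdsWithin_of_mem_nhds (huo.mem_nhds (self_mem_vadd_piPrimePowBall _ x₀)), ?_⟩
  -- its real indicator is in `L`; its null-cone value vanishes
  have hSB : (fun x => ((u.indicator (1 : (ι → K) → ℝ) x : ℝ) : ℂ)) ∈ SchwartzBruhat (ι → K) := by
    rw [hu, ofReal_indicator_vadd_piPrimePowBall_mem]
    exact indicator_vadd_piPrimePowBall_mem_schwartzBruhat (m : ℤ) x₀ 1
  obtain ⟨-, hI⟩ := hP _ hSB
  have hzero : (∫ β, ∫ x, ((u.indicator (1 : (ι → K) → ℝ) x : ℝ) : ℂ) * ((ψ (β * Q x) : Circle) : ℂ) ∂(Measure.pi fun _ : ι => μ) ∂μ) = 0 := by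
    refine nullConeIntegral_eq_zero_of_forall_ne_zero μ hd h2 Q hQ hr hSB fun x hx => ?_
    have hx' : x ∈ u := by
      have hsub : tsupport (fun x => ((u.indicator (1 : (ι → K) → ℝ) x : ℝ) : ℂ)) ⊆ u := by
        rw [hu, ofReal_indicator_vadd_piPrimePowBall_mem, ← hu]
        exact (closure_mono (Set.support_indicator_subset)).trans (huc.isClosed.closure_eq.subset)
      exact hsub hx
    exact huU hx'
  rw [hzero, Complex.zero_re, integral_indicator_one huo.measurableSet] at hI
  exact (measureReal_eq_zero_iff (huc.measure_lt_top).ne).1 hI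

/-! ## §3 The vertex mass law -/

/-- **THE VERTEX MASS LAW**: a measure integrating every real Schwartz–Bruhat `Φ` to `Re ∫∫ Φ ψ(βQ)` satisfies `σ((𝔭^{n+1})^ι) = ((q⁻¹)^{card ι}·q²)·σ((𝔭^n)^ι)` (FILE A §4 read on
the box indicators). [cite: Weil1965, Chap. I n° 2 Lemme 3, p. 7] [cite: KudlaRallis1994, §5 (5.3)–(5.6)] -/
theorem measureReal_piPrimePowBall_succ_of_forall_real (Q : QuadraticForm K (ι → K)) (σ : Measure (ι → K))
    (hP : ∀ Φ : (ι → K) → ℝ, (fun x => (Φ x : ℂ)) ∈ SchwartzBruhat (ι → K) →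
      Integrable Φ σ ∧ ∫ x, Φ x ∂σ = (∫ β, ∫ x, (Φ x : ℂ) * ((ψ (β * Q x) : Circle) : ℂ) ∂(Measure.pi fun _ : ι => μ) ∂μ).re) (n : ℤ) :
    σ.real (piPrimePowBall K ι (n + 1)) =
      (((residueFieldCard K : ℝ≥0)⁻¹ ^ Fintype.card ι * (residueFieldCard K : ℝ≥0) ^ 2 : ℝ≥0) : ℝ) * σ.real (piPrimePowBall K ι n) := by
  haveI : SecondCountableTopology K := secondCountableTopology_localField K
  have hSB : ∀ N : ℤ, (fun x => (((piPrimePowBall K ι N).indicator (1 : (ι → K) → ℝ) x : ℝ) : ℂ)) ∈ SchwartzBruhat (ι → K) := fun N => by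
    rw [ofReal_indicator_piPrimePowBall_mem]; exact indicator_piPrimePowBall_mem_schwartzBruhat N 1
  have hI : ∀ N : ℤ, σ.real (piPrimePowBall K ι N) =
      (∫ β, ∫ x, (piPrimePowBall K ι N).indicator (fun _ => (1 : ℂ)) x * ((ψ (β * Q x) : Circle) : ℂ) ∂(Measure.pi fun _ : ι => μ) ∂μ).re := by
    intro N
    rw [← integral_indicator_one (measurableSet_piPrimePowBall N), (hP _ (hSB N)).2]
    congr 1
    refine integral_congr_ae (Eventually.of_forall fun β => integral_congr_ae (Eventually.of_forall fun x => ?_))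
    exact congrArg (fun z : ℂ => z * ((ψ (β * Q x) : Circle) : ℂ)) (congr_fun (ofReal_indicator_piPrimePowBall_mem (K := K) (ι := ι) N) x)
  rw [hI, hI, nullConeIntegral_indicator_piPrimePowBall_succ μ Q n, Complex.re_ofReal_mul]

/-! ## §4 The vertex is not an atom -/

/-- **THE VERTEX HAS MEASURE ZERO**: with `3 ≤ card ι` the ratio `c = (q⁻¹)^{card ι}·q² < 1`, so `σ((𝔭^n)^ι) = c^n·σ((𝔭^0)^ι) → 0` and `{0} ⊆ ⋂_n (𝔭^n)^ι` is `σ`-null.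
[cite: Weil1965, Chap. I n° 2 Lemme 3, p. 7] [cite: KudlaRallis1994, §5 (5.3)–(5.6)] -/
theorem measure_zero_eq_zero_of_forall_real (Q : QuadraticForm K (ι → K)) (hr : 3 ≤ Fintype.card ι) (σ : Measure (ι → K)) [IsFiniteMeasureOnCompacts σ]
    (hP : ∀ Φ : (ι → K) → ℝ, (fun x => (Φ x : ℂ)) ∈ SchwartzBruhat (ι → K) →
      Integrable Φ σ ∧ ∫ x, Φ x ∂σ = (∫ β, ∫ x, (Φ x : ℂ) * ((ψ (β * Q x) : Circle) : ℂ) ∂(Measure.pi fun _ : ι => μ) ∂μ).re) :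
    σ {0} = 0 := by
  set c : ℝ := (((residueFieldCard K : ℝ≥0)⁻¹ ^ Fintype.card ι * (residueFieldCard K : ℝ≥0) ^ 2 : ℝ≥0) : ℝ) with hc
  have hq1 : (1 : ℝ) < (residueFieldCard K : ℝ) := by exact_mod_cast one_lt_residueFieldCard K
  have hc0 : 0 ≤ c := NNReal.coe_nonneg _
  have hc1 : c < 1 := by
    have hq0 : (0 : ℝ) < (residueFieldCard K : ℝ) := by linarith
    have h : c = (residueFieldCard K : ℝ) ^ 2 / (residueFieldCard K : ℝ) ^ Fintype.card ι := by
      rw [hc, NNReal.coe_mul, NNReal.coe_pow, NNReal.coe_pow, NNReal.coe_inv, NNReal.coe_natCast, inv_pow, div_eq_inv_mul]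
    rw [h, div_lt_one (pow_pos hq0 _)]
    exact pow_lt_pow_right₀ hq1 (by omega)
  -- `σ((𝔭^n)^ι) = c^n · σ((𝔭^0)^ι)`
  have hgeom : ∀ n : ℕ, σ.real (piPrimePowBall K ι (n : ℤ)) = c ^ n * σ.real (piPrimePowBall K ι 0) := by
    intro n
    induction n with
    | zero => simp
    | succ n ih =>
      rw [Nat.cast_succ, measureReal_piPrimePowBall_succ_of_forall_real μ Q σ hP (n : ℤ), ih, ← hc, pow_succ]
      ring
  have hlim : Tendsto (fun n : ℕ => c ^ n * σ.real (piPrimePowBall K ι 0)) atTop (𝓝 0) := by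
    simpa using (tendsto_pow_atTop_nhds_zero_of_lt_one hc0 hc1).mul_const (σ.real (piPrimePowBall K ι 0))
  -- `σ{0} ≤ σ((𝔭^n)^ι)` for every `n`
  have hle : ∀ n : ℕ, σ.real {0} ≤ c ^ n * σ.real (piPrimePowBall K ι 0) := fun n => by
    rw [← hgeom n]
    exact measureReal_mono (Set.singleton_subset_iff.2 (zero_mem_piPrimePowBall _)) (isCompact_piPrimePowBall (n : ℤ)).measure_lt_top.ne
  have h0 : σ.real {0} ≤ 0 := ge_of_tendsto' hlim hle
  have hfin : σ {0} ≠ ⊤ := (measure_mono (Set.singleton_subset_iff.2 (zero_mem_piPrimePowBall (0 : ℤ))) |>.trans_lt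
    (isCompact_piPrimePowBall (0 : ℤ)).measure_lt_top).ne
  exact (measureReal_eq_zero_iff hfin).1 (le_antisymm h0 measureReal_nonneg)

/-! ## §5 Existence: the sandwich road -/

/-- **THE NULL-CONE RADON MEASURE.**  For a non-degenerate quadratic form `Q` on `K^ι`, `3 ≤ card ι`, `ψ` of conductor exponent `d`, `‖2‖ = q^{−v₂}`: there is a regular Borel
measure `σ` on `K^ι`, finite on compact sets, with
(1) `∫ Ψ dσ = ∫_β ∫_x Ψ(x)·ψ(β·Q(x)) dμ^ι dμ` for every Schwartz–Bruhat `Ψ` (★ p864232 §1's `y`-stage value — LITERALLY its double integral), `Ψ` being `σ`-integrable;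
(2) `σ {Q ≠ 0} = 0` (carried by the null cone); (3) the VERTEX MASS LAW `σ((𝔭^{n+1})^ι) = ((q⁻¹)^{card ι}·q²)·σ((𝔭^n)^ι)`; (4) `σ {0} = 0`.
Construction: the sandwich road — `L` = real Schwartz–Bruhat functions, `S Φ = Re ∫∫ Φ ψ(βQ)` positive linear (FILE A), Darboux sandwich by FILE A §5, ★
`RieszRepresentation.sandwichMeasure` ∕ `integral_sandwichMeasure_eq_of_mem`; then §1–§4. [cite: Weil1965, Chap. I n° 2 Lemme 3, p. 7] [cite: Rudin1987, Ch. 2, Thm. 2.14]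
[cite: KudlaRallis1994, §5 (5.3)–(5.6)] -/
theorem exists_nullConeMeasure [Invertible (2 : K)] {d : ℤ} (hd : ψ.HasConductorExp d) {v₂ : ℤ}
    (h2 : normAbs K (2 : K) = (residueFieldCard K : ℝ≥0)⁻¹ ^ v₂) (Q : QuadraticForm K (ι → K))
    (hQ : (QuadraticMap.associated (R := K) Q).SeparatingLeft) (hr : 3 ≤ Fintype.card ι) :
    ∃ σ : Measure (ι → K), σ.Regular ∧ IsFiniteMeasureOnCompacts σ ∧
      (∀ Ψ : (ι → K) → ℂ, Ψ ∈ SchwartzBruhat (ι → K) →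
        Integrable Ψ σ ∧ ∫ x, Ψ x ∂σ = ∫ β, ∫ x, Ψ x * ((ψ (β * Q x) : Circle) : ℂ) ∂(Measure.pi fun _ : ι => μ) ∂μ) ∧
      σ {x | Q x ≠ 0} = 0 ∧
      (∀ n : ℤ, σ.real (piPrimePowBall K ι (n + 1)) =
        (((residueFieldCard K : ℝ≥0)⁻¹ ^ Fintype.card ι * (residueFieldCard K : ℝ≥0) ^ 2 : ℝ≥0) : ℝ) * σ.real (piPrimePowBall K ι n)) ∧
      σ {0} = 0 := by
  classical
  haveI : SecondCountableTopology K := secondCountableTopology_localField K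
  haveI : T2Space K := (Literature.NumberTheory.GaloisRepresentations.IsNonarchimedeanLocalField.isLocalField K).toT2Space
  haveI : LocallyCompactSpace K :=
    (Literature.NumberTheory.GaloisRepresentations.IsNonarchimedeanLocalField.isLocalField K).toLocallyCompactSpace
  -- the REAL Schwartz–Bruhat functions, an `ℝ`-submodule of `K^ι → ℝ`
  let T : ((ι → K) → ℝ) →ₗ[ℝ] ((ι → K) → ℂ) :=
    { toFun := fun Φ x => (Φ x : ℂ)
      map_add' := fun Φ Θ => funext fun x => Complex.ofReal_add _ _
      map_smul' := fun c Φ => funext fun x => by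
        simp only [Pi.smul_apply, smul_eq_mul, Complex.ofReal_mul, Complex.real_smul, RingHom.id_apply] }
  let L : Submodule ℝ ((ι → K) → ℝ) := ((SchwartzBruhat (ι → K)).restrictScalars ℝ).comap T
  have hmemL : ∀ Φ : (ι → K) → ℝ, Φ ∈ L ↔ (fun x => (Φ x : ℂ)) ∈ SchwartzBruhat (ι → K) := fun Φ => Iff.rfl
  -- the null-cone functional `S Φ = Re ∫_β ∫_x Φ ψ(βQ)`
  let S : L →ₗ[ℝ] ℝ :=
    { toFun := fun Φ => (∫ β, ∫ x, ((Φ : (ι → K) → ℝ) x : ℂ) * ((ψ (β * Q x) : Circle) : ℂ) ∂(Measure.pi fun _ : ι => μ) ∂μ).re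
      map_add' := fun Φ Θ => by
        have h := nullConeIntegral_add μ hd h2 Q hQ hr ((hmemL _).1 Φ.2) ((hmemL _).1 Θ.2)
        simp only [Submodule.coe_add, Pi.add_apply, Complex.ofReal_add]
        rw [h, Complex.add_re]
      map_smul' := fun c Φ => by
        simp only [Submodule.coe_smul, Pi.smul_apply, smul_eq_mul, Complex.ofReal_mul, RingHom.id_apply]
        rw [nullConeIntegral_smul μ Q (c : ℂ) (fun x => ((Φ : (ι → K) → ℝ) x : ℂ)), Complex.re_ofReal_mul] }
  have hSapply : ∀ Φ : L, S Φ = (∫ β, ∫ x, ((Φ : (ι → K) → ℝ) x : ℂ) * ((ψ (β * Q x) : Circle) : ℂ) ∂(Measure.pi fun _ : ι => μ) ∂μ).re :=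
    fun _ => rfl
  -- positivity
  have hS : ∀ Φ : L, 0 ≤ (Φ : (ι → K) → ℝ) → 0 ≤ S Φ := fun Φ hΦ =>
    nullConeValue_nonneg μ hd h2 Q hQ hr ((hmemL _).1 Φ.2) fun x => hΦ x
  -- the Darboux sandwich of a test function
  have hL : ∀ g : C_c((ι → K), ℝ), ∀ ε : ℝ, 0 < ε →
      ∃ Ψ₁ Ψ₂ : L, (Ψ₁ : (ι → K) → ℝ) ≤ g ∧ (g : (ι → K) → ℝ) ≤ Ψ₂ ∧ S Ψ₂ ≤ S Ψ₁ + ε := by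
    intro g ε hε
    -- a box containing the support of `g`
    obtain ⟨n₀, hn₀⟩ : ∃ n₀ : ℤ, ∀ z, z ∉ piPrimePowBall K ι n₀ → g z = 0 := by
      have hcover : tsupport g ⊆ ⋃ k : ℕ, piPrimePowBall K ι (-(k : ℤ)) := fun x _ =>
        let ⟨k, hk⟩ := exists_mem_piPrimePowBall x
        Set.mem_iUnion.2 ⟨k, hk⟩
      have hdir : Directed (· ⊆ ·) fun k : ℕ => piPrimePowBall K ι (-(k : ℤ)) :=
        Monotone.directed_le fun a b hab => piPrimePowBall_antitone (by omega)
      obtain ⟨k, hk⟩ := g.hasCompactSupport.isCompact.elim_directed_cover _ (fun k => isOpen_piPrimePowBall _) hcover hdir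
      exact ⟨-(k : ℤ), fun z hz => image_eq_zero_of_notMem_tsupport fun h => hz (hk h)⟩
    -- the box indicator `χ ∈ L`, `C := S χ ≥ 0`
    have hχ : (piPrimePowBall K ι n₀).indicator (1 : (ι → K) → ℝ) ∈ L := by
      rw [hmemL, ofReal_indicator_piPrimePowBall_mem]
      exact indicator_piPrimePowBall_mem_schwartzBruhat n₀ 1
    have hC : 0 ≤ S ⟨_, hχ⟩ := hS ⟨_, hχ⟩ fun x => Set.indicator_nonneg (fun _ _ => zero_le_one) _
    set C : ℝ := S ⟨_, hχ⟩ with hCdef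
    have hδ : 0 < ε / (2 * C + 2) := by positivity
    obtain ⟨Φ, hΦlc, hΦs, hΦε⟩ := exists_isLocallyConstant_approx g hn₀ hδ
    have hΦL : Φ ∈ L := by
      rw [hmemL, mem_schwartzBruhat_iff]
      refine ⟨hΦlc.comp (fun r : ℝ => (r : ℂ)), HasCompactSupport.intro' (isCompact_piPrimePowBall n₀) (isClosed_piPrimePowBall n₀) fun x hx => ?_⟩
      simp only [hΦs x hx, Complex.ofReal_zero]
    refine ⟨⟨Φ, hΦL⟩ - (ε / (2 * C + 2)) • ⟨_, hχ⟩, ⟨Φ, hΦL⟩ + (ε / (2 * C + 2)) • ⟨_, hχ⟩, fun z => ?_, fun z => ?_, ?_⟩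
    · simp only [Submodule.coe_sub, Submodule.coe_smul, Pi.sub_apply, Pi.smul_apply, smul_eq_mul]
      by_cases hz : z ∈ piPrimePowBall K ι n₀
      · rw [Set.indicator_of_mem hz, Pi.one_apply, mul_one]
        linarith [(abs_le.1 (hΦε z)).1, (abs_le.1 (hΦε z)).2]
      · rw [Set.indicator_of_notMem hz, mul_zero, sub_zero, hΦs z hz, hn₀ z hz]
    · simp only [Submodule.coe_add, Submodule.coe_smul, Pi.add_apply, Pi.smul_apply, smul_eq_mul]
      by_cases hz : z ∈ piPrimePowBall K ι n₀
      · rw [Set.indicator_of_mem hz, Pi.one_apply, mul_one]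
        linarith [(abs_le.1 (hΦε z)).1, (abs_le.1 (hΦε z)).2]
      · rw [Set.indicator_of_notMem hz, mul_zero, add_zero, hΦs z hz, hn₀ z hz]
    · rw [map_add, map_sub, map_smul, smul_eq_mul, ← hCdef]
      have h1 : ε / (2 * C + 2) * C + ε / (2 * C + 2) * C ≤ ε := by
        rw [← two_mul, ← mul_assoc, mul_comm (2 : ℝ), mul_assoc, div_mul_eq_mul_div]
        rw [div_le_iff₀ (by positivity)]
        nlinarith
      linarith
  -- the measure
  haveI hreg : (sandwichMeasure hS hL).Regular := regular_sandwichMeasure hS hL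
  -- the real identity on `L`
  have hP : ∀ Φ : (ι → K) → ℝ, (fun x => (Φ x : ℂ)) ∈ SchwartzBruhat (ι → K) →
      Integrable Φ (sandwichMeasure hS hL) ∧ ∫ x, Φ x ∂(sandwichMeasure hS hL) =
        (∫ β, ∫ x, (Φ x : ℂ) * ((ψ (β * Q x) : Circle) : ℂ) ∂(Measure.pi fun _ : ι => μ) ∂μ).re := by
    intro Φ hΦ
    have hΦL : Φ ∈ L := (hmemL Φ).2 hΦ
    have hc : Continuous Φ := by
      have h := (mem_schwartzBruhat_iff.1 hΦ).1.continuous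
      simpa only [Function.comp_def, Complex.ofReal_re] using Complex.continuous_re.comp h
    have hcs : HasCompactSupport Φ := by
      have h := (mem_schwartzBruhat_iff.1 hΦ).2
      simpa only [Function.comp_def, Complex.ofReal_re] using h.comp_left (g := Complex.re) Complex.zero_re
    exact integral_sandwichMeasure_eq_of_mem hS hL ⟨Φ, hΦL⟩ hc fun ε hε =>
      ⟨⟨Φ, hΦL⟩, 0, hc, hcs, by rw [Submodule.coe_zero]; exact continuous_zero, fun x => by simp, by rw [map_zero]; exact hε.le⟩
  exact ⟨sandwichMeasure hS hL, hreg, inferInstance,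
    fun Ψ hΨ => integral_eq_nullConeIntegral_of_forall_real μ hd h2 Q hQ hr _ hP hΨ,
    measure_setOf_ne_zero_eq_zero_of_forall_real μ hd h2 Q hQ hr _ hP,
    measureReal_piPrimePowBall_succ_of_forall_real μ Q _ hP, measure_zero_eq_zero_of_forall_real μ Q hr _ hP⟩

end Summit.HodgeConjecture.HodgeConjecture.Cruxes.HLiu418.K2LiuNullConeRadonMeasure

end
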